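import Summits.CriticalPhenomena.SAWScalingLimit.Theorems.SAWRestrictionRigidityLimitExists
import Summits.CriticalPhenomena.SAWScalingLimit.Theorems.SAWRestrictionRigidityLimitExistsCocycleOfAvoidanceLimit
import Summits.CriticalPhenomena.SAWScalingLimit.Theorems.SAWRenewalTightnessEventualTightOfItems
import Summits.CriticalPhenomena.SAWScalingLimit.Theorems.SAWLoopFugacityFlowSimpleSubseqLimitsSlitLine
import Summits.CriticalPhenomena.SAWScalingLimit.Theorems.SAWWeldingIdentificationEventualTightSplit
import HarnessLib

/-!
# `LimitExists` (crux stmt-CriticalPhenomena-1371) from the four current research LEAVES of the hub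

Route `SAWRestrictionRigidity` of `CriticalPhenomena/SAWScalingLimit`; line `registered`
(`Cruxes/LimitExists/Lines/birth.lean`), lead c4.

The registered skeleton closes the crux modulo the three items (T) `EventualTight` (stmt-1372), (S)
`SimpleSubseqLimits` (stmt-4982), (C) `AvoidanceCocycleLimit` (stmt-1369) (`LimitExists_of_items`, p145872).  Each of
these is by now itself reduced, kernel-checked, to research leaves under its own crux chain:

* (T) ⟸ `VirginArcTraversalTight` (stmt-17940) ∧ `ConfinementPositivity` (stmt-17587):
  `EventualTight_of_items` (`Theorems/SAWRenewalTightnessEventualTightOfItems`, lead chain of stmt-1372);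
* (S) ⟸ `SequentialSlitAvoidance` ∧ `AvoidanceLimit` (stmt-10649): `line_slitContinuousRestriction`
  (`Theorems/SAWLoopFugacityFlowSimpleSubseqLimitsSlitLine`, lead c9 of stmt-4982, p154999);
* (C) ⟸ `AvoidanceLimit` (stmt-10649): `avoidanceCocycleLimit_of_avoidanceLimit` (p145541).

Composed here BY NAME: **`limitExists_of_leaves : VirginArcTraversalTight → ConfinementPositivity →
SequentialSlitAvoidance → AvoidanceLimit → LimitExists`** — the existence half of the SAW scaling limit, shared by
eight routes, hinges on exactly these four lattice statements (2026-08-17).  Pure glue, standard axioms. [folklore]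
-/

noncomputable section

namespace Summit.CriticalPhenomena.SAWScalingLimit.Theorems.SAWRestrictionRigidityLimitExists

open Summit.CriticalPhenomena.SAWScalingLimit.Theses

/-- (T) of route `SAWRestrictionRigidity` is verbatim (T) of route `SAWRenewalTightness` (the shared item
stmt-CriticalPhenomena-1372), definitionally. [folklore] -/
theorem eventualTight_iff_renewalTightness_eventualTight :
    SAWRestrictionRigidity.EventualTight ↔ SAWRenewalTightness.EventualTight :=
  Iff.rfl

/-- **The crux from the four current research leaves of the hub.**  `VirginArcTraversalTight` (stmt-17940) and
`ConfinementPositivity` (stmt-17587) give eventual tightness (T) (`EventualTight_of_items`); `SequentialSlitAvoidance`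
and `AvoidanceLimit` (stmt-10649) give the simple boundary-avoiding carriers (S) (`line_slitContinuousRestriction`);
`AvoidanceLimit` gives the value-free avoidance cocycle limit (C) (`avoidanceCocycleLimit_of_avoidanceLimit`); and
(T), (S), (C) give `LimitExists` (`LimitExists_of_items`, the registered line). [folklore] -/
theorem limitExists_of_leaves : Summit.CriticalPhenomena.SAWScalingLimit.Theses.SAWExcursionCardy.VirginArcTraversalTight → Summit.CriticalPhenomena.SAWScalingLimit.Theses.SAWRenewalTightness.ConfinementPositivity → Summit.CriticalPhenomena.SAWScalingLimit.Theorems.SimpleSubseqLimits.SlitRestriction.Transfer.SequentialSlitAvoidance → Summit.CriticalPhenomena.SAWScalingLimit.Theses.SAWLoopFugacityFlow.AvoidanceLimit → Summit.CriticalPhenomena.SAWScalingLimit.Theses.SAWRestrictionRigidity.LimitExists :=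
  fun hX hE hσ hA => LimitExists_of_items (EventualTight_of_items hX hE)
    (Summit.CriticalPhenomena.SAWScalingLimit.Theorems.SimpleSubseqLimits.SlitRestriction.Line.line_slitContinuousRestriction
      hσ hA)
    (avoidanceCocycleLimit_of_avoidanceLimit hA)


/-- (T) of route `SAWRestrictionRigidity` is verbatim (T) of route `SAWWeldingIdentification`, definitionally (both are the
shared item stmt-CriticalPhenomena-1372). [folklore] -/
theorem eventualTight_iff_weldingIdentification_eventualTight :
    SAWRestrictionRigidity.EventualTight ↔ SAWWeldingIdentification.EventualTight :=
  Iff.rfl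

/-- `ConfinementPositivity` of route `SAWRenewalTightness` is verbatim `ConfinementPositivity` of route
`SAWWeldingIdentification`, definitionally (both are the shared item stmt-CriticalPhenomena-17587). [folklore] -/
theorem renewalTightness_confinementPositivity_iff_weldingIdentification :
    SAWRenewalTightness.ConfinementPositivity ↔ SAWWeldingIdentification.ConfinementPositivity :=
  Iff.rfl

/-- **The crux from the four CURRENT research leaves of the hub, bounded form (2026-08-17, lead c5).**  Since lead c4's
`limitExists_of_leaves` the tightness chain of stmt-1372 was re-split (welding split, glue p151500): consumers need only the
BOUNDED-EXTERIOR atom `VirginArcTraversalTightBounded` (stmt-CriticalPhenomena-18042, exteriors `Λ` finite and inside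
`closedBall z₀ (C N)`), which is implied by the all-exteriors atom `VirginArcTraversalTight` (stmt-17940,
`VirginArcTraversalTightBounded_of_item`) — so this form is STRONGER than `limitExists_of_leaves`.  Composition by name:
`EventualTightSWI_of_items` (18042 ∧ 17587 ⟹ 1372), `line_slitContinuousRestriction` (SequentialSlitAvoidance ∧ 10649 ⟹ 4982,
p154999), `avoidanceCocycleLimit_of_avoidanceLimit` (10649 ⟹ 1369, p145541), `LimitExists_of_items` (p145872). [folklore] -/
theorem limitExists_of_leaves_bounded : Summit.CriticalPhenomena.SAWScalingLimit.Theses.SAWWeldingIdentification.VirginArcTraversalTightBounded → Summit.CriticalPhenomena.SAWScalingLimit.Theses.SAWRenewalTightness.ConfinementPositivity → Summit.CriticalPhenomena.SAWScalingLimit.Theorems.SimpleSubseqLimits.SlitRestriction.Transfer.SequentialSlitAvoidance → Summit.CriticalPhenomena.SAWScalingLimit.Theses.SAWLoopFugacityFlow.AvoidanceLimit → Summit.CriticalPhenomena.SAWScalingLimit.Theses.SAWRestrictionRigidity.LimitExists :=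
  fun hX hE hσ hA => LimitExists_of_items (Summit.CriticalPhenomena.SAWScalingLimit.Theorems.EventualTightSWI_of_items hX hE)
    (Summit.CriticalPhenomena.SAWScalingLimit.Theorems.SimpleSubseqLimits.SlitRestriction.Line.line_slitContinuousRestriction
      hσ hA)
    (avoidanceCocycleLimit_of_avoidanceLimit hA)

/-- The all-exteriors leaf census `limitExists_of_leaves` (lead c4) recovered from the bounded one through
`VirginArcTraversalTightBounded_of_item` (stmt-17940 ⟹ stmt-18042) — recorded so that the two censuses are visibly
comparable: the bounded form has the weaker first hypothesis. [folklore] -/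
theorem limitExists_of_leaves_of_bounded :
    Summit.CriticalPhenomena.SAWScalingLimit.Theses.SAWExcursionCardy.VirginArcTraversalTight →
      Summit.CriticalPhenomena.SAWScalingLimit.Theses.SAWRenewalTightness.ConfinementPositivity →
        Summit.CriticalPhenomena.SAWScalingLimit.Theorems.SimpleSubseqLimits.SlitRestriction.Transfer.SequentialSlitAvoidance →
          Summit.CriticalPhenomena.SAWScalingLimit.Theses.SAWLoopFugacityFlow.AvoidanceLimit →
            Summit.CriticalPhenomena.SAWScalingLimit.Theses.SAWRestrictionRigidity.LimitExists :=
  fun hX => limitExists_of_leaves_bounded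
    (Summit.CriticalPhenomena.SAWScalingLimit.Theorems.VirginArcTraversalTightBounded_of_item hX)

end Summit.CriticalPhenomena.SAWScalingLimit.Theorems.SAWRestrictionRigidityLimitExists

end
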